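import Summits.Ventures.HodgeRepro2.T5SU11KernelDiagonalMonotone
import Summits.Ventures.HodgeRepro2.T5SU11SphericalDecayMonotoneLam
import Summits.Ventures.HodgeRepro2.T5SU11SphericalDecayDifferenceOrigin
import Summits.Ventures.HodgeRepro2.T5SU11KernelCompositionCorner

/-!
# Summary XXXII — the diagonal, the spectral-parameter monotonicity, the resolvent of a decaying solution, the cancellation of
the logarithmic singularities, and the composed kernel at the corner (rows 641–645), under uniform names

Throughout `μ = λ(λ − 2)`, `K_λ` the kernel of `G^I_λ`, `K_λ^{∘2}(t, s) = ∫ K_λ(t, r) K_λ(r, s) sinh 2r dr`, `χ_λ` the decaying solution.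

* `diagonal_deriv`, `diagonal_strictMono_of_le_two`, `kernel_le_diagonal_of_le` — **`(K_λ(t, t))′ = 1/sinh 2t − 2 φ_λ′ χ_λ`; the diagonal
  is strictly increasing for `λ ≤ 2`; `|K_λ(t, s)| ≤ φ_λ(a_a) χ_λ(a)` for `min(t, s) ≥ a`** (row 641);
* `decay_anti_lam` — **`χ_λ(s) ≤ χ_{λ₂}(s)` for `1 < λ₂ ≤ λ`** (row 642);
* `kernel_le_mul_decay_of_le_one`, `decay_mul_decay_integrable`, `resolvent_decay` — **`|K_λ(t, r)| ≤ Φ χ_λ(r)` for `t ≤ 1`;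
  `χ_{λ₂} χ_λ sinh 2r ∈ L¹(0, ∞)`; `G^I_{λ₂} χ_λ = (χ_λ − χ_{λ₂})/(μ − μ₂)`** (row 643);
* `decay_sub_origin` — **`χ_λ(t) − χ_{λ₂}(t) → −(μ − μ₂) ∫ χ_{λ₂} χ_λ sinh 2s ds` as `t → 0⁺`** (row 644);
* `kernel_comp_two_corner_bound`, `kernel_comp_two_corner` — **`K_λ^{∘2}` is bounded on the corner square and
  `K_λ^{∘2}(t, s) → ∫ χ_λ² sinh 2r dr` as `(t, s) → (0, 0)`** (row 645).

Nothing is claimed about (N).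

Blind lane: Mathlib + the HodgeRepro2 prefix only; no sorry; axioms ⊆ {propext, Classical.choice,
Quot.sound}.
-/

namespace Summit.Ventures.HodgeRepro2.T5SU11RadialSummaryXXXII

open Filter Topology MeasureTheory
open Set (Ioi Ioc Icc)
open T5SU11Cartan T5SU11SphericalFunction T5SU11SphericalDecay T5SU11RadialGreenKernel T5SU11RadialGreenImproper
  T5SU11KernelDiagonalMonotone T5SU11SphericalDecayMonotoneLam T5SU11ResolventOfDecaySolution
  T5SU11SphericalDecayDifferenceOrigin T5SU11KernelCompositionCorner

section measure

variable [MeasurableSpace Circle] [BorelSpace Circle]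

variable {lam lam₂ : ℝ} (hlam : 1 < lam) (hlam₂ : 1 < lam₂)

include hlam in
/-- **`(K_λ(t, t))′ = 1/sinh 2t − 2 φ_λ′(a_t) χ_λ(t)`** (row 641). -/
theorem diagonal_deriv {t : ℝ} (ht : 0 < t) :
    HasDerivAt (fun t => sphGreenKernel lam t t)
      ((Real.sinh (2 * t))⁻¹ - 2 * deriv (fun t => sph lam (hyp t)) t * sphDecay lam t) t :=
  hasDerivAt_kernel_diagonal hlam ht

include hlam in
/-- **The diagonal is strictly increasing for `1 < λ ≤ 2`** (row 641). -/
theorem diagonal_strictMono_of_le_two (h2 : lam ≤ 2) : StrictMonoOn (fun t => sphGreenKernel lam t t) (Ioi 0) :=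
  kernel_diagonal_strictMonoOn_of_le_two hlam h2

include hlam in
/-- **The corner-away uniform bound** for `1 < λ ≤ 2` (row 641). -/
theorem kernel_le_diagonal_of_le (h2 : lam ≤ 2) {a t s : ℝ} (ha : 0 < a) (hat : a ≤ t) (has : a ≤ s) :
    |sphGreenKernel lam t s| ≤ sph lam (hyp a) * sphDecay lam a :=
  abs_kernel_le_diagonal_of_le hlam h2 ha hat has

include hlam hlam₂ in
/-- **`χ_λ(s) ≤ χ_{λ₂}(s)` for `1 < λ₂ ≤ λ`** (row 642). -/
theorem decay_anti_lam (hle : lam₂ ≤ lam) {s : ℝ} (hs : 0 < s) : sphDecay lam s ≤ sphDecay lam₂ s :=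
  sphDecay_anti_lam hlam hlam₂ hle hs

include hlam in
/-- **`|K_λ(t, r)| ≤ Φ χ_λ(r)` for `0 < t ≤ 1`** (row 643). -/
theorem kernel_le_mul_decay_of_le_one {Φ : ℝ} (hΦ : ∀ u ∈ Icc (0 : ℝ) 1, sph lam (hyp u) ≤ Φ)
    {t r : ℝ} (ht : 0 < t) (ht1 : t ≤ 1) (hr : 0 < r) : |sphGreenKernel lam t r| ≤ Φ * sphDecay lam r :=
  abs_kernel_le_mul_sphDecay_of_le_one hlam hΦ ht ht1 hr

include hlam hlam₂ in
/-- **`χ_{λ₂} χ_λ sinh 2r ∈ L¹(0, ∞)`** (row 643). -/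
theorem decay_mul_decay_integrable :
    IntegrableOn (fun r => sphDecay lam₂ r * sphDecay lam r * Real.sinh (2 * r)) (Ioi 0) :=
  integrableOn_sphDecay_mul_sphDecay_mul_sinh hlam hlam₂

include hlam hlam₂ in
/-- **`G^I_{λ₂} χ_λ = (χ_λ − χ_{λ₂})/(μ − μ₂)`** (row 643). -/
theorem resolvent_decay (hne : lam ≠ lam₂) {s : ℝ} (hs : 0 < s) :
    greenSolI (fun t => sph lam₂ (hyp t)) (sphDecay lam₂) (sphDecay lam) s
      = (sphDecay lam s - sphDecay lam₂ s) / (lam * (lam - 2) - lam₂ * (lam₂ - 2)) :=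
  greenSolI_sphDecay_eq hlam hlam₂ hne hs

include hlam hlam₂ in
/-- **The logarithmic singularities cancel** (row 644). -/
theorem decay_sub_origin (hne : lam ≠ lam₂) :
    Tendsto (fun t => sphDecay lam t - sphDecay lam₂ t) (𝓝[>] 0)
      (𝓝 (-((lam * (lam - 2) - lam₂ * (lam₂ - 2)) * ∫ s in Ioi 0, sphDecay lam₂ s * sphDecay lam s * Real.sinh (2 * s)))) :=
  tendsto_sphDecay_sub_nhdsGT_zero hlam hlam₂ hne

include hlam in
/-- **`K_λ^{∘2}` is uniformly bounded on the corner square** (row 645). -/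
theorem kernel_comp_two_corner_bound {Φ : ℝ} (hΦ : ∀ u ∈ Icc (0 : ℝ) 1, sph lam (hyp u) ≤ Φ) (hΦ0 : 0 ≤ Φ)
    {t s : ℝ} (ht : 0 < t) (ht1 : t ≤ 1) (hs : 0 < s) (hs1 : s ≤ 1) :
    |((greenSolI (fun t => sph lam (hyp t)) (sphDecay lam))^[1] (fun u => sphGreenKernel lam u s)) t|
      ≤ Φ ^ 2 * ∫ r in Ioi 0, sphDecay lam r * sphDecay lam r * Real.sinh (2 * r) :=
  abs_kernel_comp_two_le_corner hlam hΦ hΦ0 ht ht1 hs hs1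

include hlam in
/-- **`K_λ^{∘2}(t, s) → ∫ χ_λ² sinh 2r dr` as `(t, s) → (0, 0)`** (row 645). -/
theorem kernel_comp_two_corner :
    Tendsto (fun p : ℝ × ℝ => ∫ r in Ioi 0, sphGreenKernel lam p.1 r * sphGreenKernel lam r p.2 * Real.sinh (2 * r))
      (𝓝[>] 0 ×ˢ 𝓝[>] 0) (𝓝 (∫ r in Ioi 0, sphDecay lam r * sphDecay lam r * Real.sinh (2 * r))) :=
  tendsto_kernel_comp_two_corner hlam

end measure

end Summit.Ventures.HodgeRepro2.T5SU11RadialSummaryXXXII
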